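import Summits.Ventures.HodgeRepro2.T5SU11JacobiPhaseLawEven
import Summits.Ventures.HodgeRepro2.T5SU11JacobiPhaseMomentsFour

/-!
# The phase moments at every even integer parameter `λ = 2n + 2` as partial-fraction sums:
`∫_0^∞ sᵐ e^{−(k−2)s} Φ_{2n+2}(s) ds = m! Σ_{i ≤ n} c_{n,i}/(k − 2 − 2i)^{m+1}`, `⟨(log|a|)ᵐ⟩_{k,2n+2}` as a ratio of two such sums

With `Φ_{2n+2}(s) = Σ_{i ≤ n} c_{n,i} e^{2is}` (`T5SU11JacobiPhaseLawEven.sphPhase_even_eq_sum`, `c_{n,i}` the coefficients of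
the shifted Legendre polynomial `Q_n = P_n(2X − 1)`) every moment integral of the phase is a finite sum of Euler
integrals (`T5SU11JacobiPhaseMomentsFour.integral_pow_mul_exp_neg_mul_mul_exp_Ioi`):

  **`A_m := ∫_0^∞ sᵐ e^{−(k−2)s} Φ_{2n+2}(s) ds = m! Σ_{i ≤ n} c_{n,i}/(k − 2 − 2i)^{m+1}`**   (`moment_even_eq`, `k > 2n + 2`),

so the normalised moments of the phase under `m_k φ_{2n+2} dν` are ratios of two partial-fraction sums,

  **`⟨(log|a|)ᵐ⟩_{k,2n+2} = m! (Σ_i c_{n,i}/(k − 2 − 2i)^{m+1}) / (Σ_i c_{n,i}/(k − 2 − 2i))`**   (`normalized_moment_even_eq`),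

in particular **`⟨log|a|⟩_{k,2n+2} = (Σ_i c_{n,i}/(k − 2 − 2i)²)/(Σ_i c_{n,i}/(k − 2 − 2i))`** (`mean_phase_even_eq`) — the
general form of the `λ = 4, 6` closed forms of `T5SU11JacobiPhaseMomentsFour`. Nothing is claimed about (N).

Blind lane: Mathlib + the HodgeRepro2 prefix only; no sorry; axioms ⊆ {propext, Classical.choice,
Quot.sound}.
-/

namespace Summit.Ventures.HodgeRepro2.T5SU11JacobiPhaseMomentsEven

open MeasureTheory MeasureTheory.Measure Metric Set Filter Topology Polynomial Finset
open T5SU11Unimodular T5SU11Fibration T5SU11Cartan T5SU11OneParameter T5SU11CartanProjection T5HaarCircle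
  T5BergmanCoefficient T5SU11FibrationHaar T5SU11SphericalFunction T5SU11SphericalSymmetry
  T5SU11SphericalBounds T5SU11SphericalContinuous T5SU11JacobiLaplacePhase T5SU11PhaseLawLintegral
  T5SU11JacobiPhaseLawRate T5SU11JacobiMeanPhaseRate T5SU11JacobiMeanPhaseOutside T5SU11JacobiPhaseLawInteger
  T5SU11JacobiPhaseLawEven T5SU11JacobiPhaseMomentsFour T5SU11JacobiWeight T5SU11KFiniteMajorantPow
open scoped Real

section measure

variable [MeasurableSpace Circle] [BorelSpace Circle]

/-- **The moment integrals at `λ = 2n + 2`**: for `k > 2n + 2`,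
`∫_0^∞ sᵐ e^{−(k−2)s} Φ_{2n+2}(s) ds = m! Σ_{i ≤ n} c_{n,i}/(k − 2 − 2i)^{m+1}`. -/
theorem moment_even_eq (m n : ℕ) {k : ℝ} (hk : 2 * (n : ℝ) + 2 < k) :
    ∫ s in Ioi (0 : ℝ), s ^ m * Real.exp (-((k - 2) * s)) * sphPhase (2 * (n : ℝ) + 2) s
      = (m.factorial : ℝ) * ∑ i ∈ range (n + 1), (legShift n).coeff i / (k - 2 - 2 * (i : ℝ)) ^ (m + 1) := by
  have hi : ∀ i ∈ range (n + 1), 2 * (i : ℝ) < k - 2 := fun i hi => by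
    have : (i : ℝ) ≤ n := by exact_mod_cast Nat.lt_succ_iff.mp (Finset.mem_range.mp hi)
    linarith
  have e : ∫ s in Ioi (0 : ℝ), s ^ m * Real.exp (-((k - 2) * s)) * sphPhase (2 * (n : ℝ) + 2) s
      = ∫ s in Ioi (0 : ℝ), ∑ i ∈ range (n + 1),
          (legShift n).coeff i * (s ^ m * Real.exp (-((k - 2) * s)) * Real.exp (2 * (i : ℝ) * s)) := by
    refine setIntegral_congr_fun measurableSet_Ioi fun s hs => ?_
    rw [sphPhase_even_eq_sum n (le_of_lt hs), Finset.mul_sum]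
    refine Finset.sum_congr rfl fun i _ => ?_
    ring
  rw [e, integral_finsetSum _ fun (i : ℕ) hi' =>
    (integrableOn_pow_mul_exp_neg_mul_mul_exp_Ioi m (r := k - 2) (c := 2 * (i : ℝ)) (hi i hi')).const_mul _,
    Finset.mul_sum]
  refine Finset.sum_congr rfl fun i hi' => ?_
  rw [integral_const_mul, integral_pow_mul_exp_neg_mul_mul_exp_Ioi m (hi i hi')]
  ring

/-- **The normalised moments of the phase at `λ = 2n + 2`**: on the ray (`k > 2n + 2`),
`⟨(log|a|)ᵐ⟩_{k,2n+2} = m! (Σ_i c_{n,i}/(k − 2 − 2i)^{m+1})/(Σ_i c_{n,i}/(k − 2 − 2i))`. -/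
theorem normalized_moment_even_eq (m n : ℕ) {k : ℝ} (hk : 2 * (n : ℝ) + 2 < k) :
    (∫ g, Real.log ‖mat g 0 0‖ ^ m * ((1 - ‖orbit g‖ ^ 2) ^ (k / 2) * sph (2 * (n : ℝ) + 2) g) ∂(nu haarCircle))
        / (∫ g, (1 - ‖orbit g‖ ^ 2) ^ (k / 2) * sph (2 * (n : ℝ) + 2) g ∂(nu haarCircle))
      = (m.factorial : ℝ) * (∑ i ∈ range (n + 1), (legShift n).coeff i / (k - 2 - 2 * (i : ℝ)) ^ (m + 1))
        / ∑ i ∈ range (n + 1), (legShift n).coeff i / (k - 2 - 2 * (i : ℝ)) := by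
  have hn0 : (0 : ℝ) ≤ n := Nat.cast_nonneg n
  have hA0 := moment_even_eq 0 n hk
  simp only [pow_zero, one_mul, Nat.factorial_zero, Nat.cast_one, zero_add, pow_one] at hA0
  rw [normalized_moment_eq_phase' m (by linarith) hk (by linarith), moment_even_eq m n hk, hA0]

/-- **The mean phase at `λ = 2n + 2`**: `⟨log|a|⟩_{k,2n+2} = (Σ_i c_{n,i}/(k − 2 − 2i)²)/(Σ_i c_{n,i}/(k − 2 − 2i))`. -/
theorem mean_phase_even_eq (n : ℕ) {k : ℝ} (hk : 2 * (n : ℝ) + 2 < k) :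
    (∫ g, Real.log ‖mat g 0 0‖ * ((1 - ‖orbit g‖ ^ 2) ^ (k / 2) * sph (2 * (n : ℝ) + 2) g) ∂(nu haarCircle))
        / (∫ g, (1 - ‖orbit g‖ ^ 2) ^ (k / 2) * sph (2 * (n : ℝ) + 2) g ∂(nu haarCircle))
      = (∑ i ∈ range (n + 1), (legShift n).coeff i / (k - 2 - 2 * (i : ℝ)) ^ 2)
        / ∑ i ∈ range (n + 1), (legShift n).coeff i / (k - 2 - 2 * (i : ℝ)) := by
  have h := normalized_moment_even_eq 1 n hk
  simp only [pow_one, Nat.factorial_one, Nat.cast_one, one_mul, Nat.reduceAdd] at h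
  exact h

end measure

end Summit.Ventures.HodgeRepro2.T5SU11JacobiPhaseMomentsEven
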